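import Summits.QuantumFields.YangMills.Theorems.UnitScaleTiltProp7PinnedRegaugeChartBCH
import Literature.MathematicalPhysics.QuantumFieldTheory.Balaban1983to89.T3PrintedRegularOrbits
import Literature.MathematicalPhysics.QuantumFieldTheory.Balaban1983to89.T4WilsonGaugeFlatDirection
import HarnessLib

/-!
# Route `UnitScaleTilt`, crux K1 child «MinimiserStabilityRegPr» (stmt-QuantumFields-19200) — STEP 3 OF THE (α′) KNIT:
# a PINNED re-gauging `Y := X^u` of a fibre point `X` with the competitor's action is again a fibre point with the competitor's action, and its sup chart is
# `‖Y_bW_b⁻¹ − 1‖ ≤ ‖X_bW_b⁻¹ − 1‖ + ‖u(b₋) − W_b·u(b₊)·W_b*‖` — the first three conjuncts of ✓`stub_PV3E_of_fibrePointSlice`'s per-competitor datum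

Cell `ym3-torus` ∕ fleet seat `ym-ust-19200-p1` (gen 14, route-R lead ∕ (n3) namer).  THEOREMS ONLY (0 `def`, 0 `sorry`); `--supports stmt-QuantumFields-19200`, count-neutral.
YM₃ on T³ is a ladder rung (R3), not the Clay problem; nothing here claims the stub, the crux, d = 4 or the mass gap.

WHY (KNIT-ALPHA-PRIME-g14.md STEP 3).  The gauge-free E′ door ✓`Prop7LocMinOfPinnedChartSlice.stub_PV3E_of_fibrePointSlice` asks per competitor `W′` for SOME `Y ∈ (6)(e) ∩ 𝔅_k(V)`
with `A(Y) = A(W′)`, an `sQℓ⁻¹` sup chart and one slice inequality.  The inhabitant of record is `Y := (X^{g‴})^{e^{−Iψ}}`: `X^{g‴}` the untwisted print representative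
(✓`Prop7UntwistChartOfTwist`), `e^{−Iψ}` the PINNED centre-harmonic corrector (✓`Prop7CentreHarmonicRegaugeSup(Cov)`).  This file is the bookkeeping of that step in the
door's letters: (4)-invariance of (6)(e) ∩ 𝔅_k(V) (✓`gaugeAct_mem_regFibrePr_iff_of_trivial`), gauge invariance of the action (✓`wilsonAction_gaugeAct`), and px15's sup row
✓`Prop7PinnedRegaugeChartBCH.norm_pertVar_gaugeAct_le` (the corrector enters through its COVARIANT DIFFERENCE `u(b₋) − W_b u(b₊) W_b*`, which is `ℓ⁻¹`-small for the S_H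
corrector, not through `‖u − 1‖`).  `pertVar W Y b = ↑(Y b·(W b)⁻¹) − 1` is the door's chart letter by `rfl`.

WHAT IS PROVED (ns `…Theorems.Prop7FibrePointOfPinnedRegauge`; T³, `SU(2)`): ★★ `fibrePoint_rows_of_pinned_regauge`.
HONEST SCOPE.  Bookkeeping over landed theorems; the slice inequality (STEP 4) is not here.

References: T. Bałaban, CMP 102 (1985) 277–309 [Balaban1985Variational] ((4)–(7) p.278, (14)–(15) p.280); CMP 98 (1985) 17–51 [Balaban1985Averaging] ((9), (11) p.19).
-/

noncomputable section

open scoped Matrix.Norms.L2Operator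

namespace Summit.QuantumFields.YangMills.Theorems.Prop7FibrePointOfPinnedRegauge

open Literature.MathematicalPhysics.QuantumFieldTheory.Balaban1983to89
open T4Continuum
open Literature.MathematicalPhysics.QuantumFieldTheory.Balaban1983to89.T3ContinuumYM3Torus
open Literature.MathematicalPhysics.QuantumFieldTheory.Balaban1983to89.T3PrintedRegularMinimiser (regFibrePr)
open Literature.MathematicalPhysics.QuantumFieldTheory.Balaban1983to89.T3PrintedRegularOrbits (descTransf gaugeAct_mem_regFibrePr_iff_of_trivial)
open BlockAveragingEMLLinearisedBackground (pertVar)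
open Summit.QuantumFields.YangMills.Theorems.Prop7PinnedRegaugeChartBCH (norm_pertVar_gaugeAct_le)

section T3

variable (F : T3Family) {n K : ℕ} (h : n ≤ K)

/-- ★★ **STEP 3 OF THE (α′) KNIT — a pinned re-gauging of a fibre point with the competitor's action is an admissible `Y` for the gauge-free door, with the
summed sup chart.**  `e ≥ 0`; `X ∈ (6)(e) ∩ 𝔅_k(V)` with `A(W′) = A(X)`; `u` PINNED (`u↓ = 1`); `‖X_bW_b⁻¹ − 1‖ ≤ a` and `‖u(b₋) − W_b u(b₊) W_b*‖ ≤ c` on every bond.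
Then `Y := X^u ∈ (6)(e) ∩ 𝔅_k(V)`, `A(W′) = A(Y)`, and `‖Y_bW_b⁻¹ − 1‖ ≤ a + c` on every bond (the door's chart letter).
[cite: Balaban1985Variational, (4)-(7) p.278, (14)-(15) p.280; Balaban1985Averaging, (9) p.19, (11) p.19] -/
theorem fibrePoint_rows_of_pinned_regauge {e : ℝ} (he : 0 ≤ e)
    {V : GaugeField (F.P n) 0 (Matrix.specialUnitaryGroup (Fin 2) ℂ)}
    (W W' X : GaugeField (F.P K) 0 (Matrix.specialUnitaryGroup (Fin 2) ℂ))
    (hX : X ∈ regFibrePr F n K h e V) (hA : wilsonAction4 W' = wilsonAction4 X)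
    (u : GaugeTransf (F.P K) 0 (Matrix.specialUnitaryGroup (Fin 2) ℂ)) (hu : descTransf F n K h u = fun _ => 1)
    {a c : ℝ} (hsup : ∀ b : PBond (F.P K) 0, ‖pertVar W X b‖ ≤ a)
    (hcorr : ∀ b : PBond (F.P K) 0, ‖((u b.src : Matrix.specialUnitaryGroup (Fin 2) ℂ) : Matrix (Fin 2) (Fin 2) ℂ)
        - ((W b : Matrix.specialUnitaryGroup (Fin 2) ℂ) : Matrix (Fin 2) (Fin 2) ℂ) * ((u b.tgt : Matrix.specialUnitaryGroup (Fin 2) ℂ) : Matrix (Fin 2) (Fin 2) ℂ)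
            * star ((W b : Matrix.specialUnitaryGroup (Fin 2) ℂ) : Matrix (Fin 2) (Fin 2) ℂ)‖ ≤ c) :
    GaugeField.gaugeAct u X ∈ regFibrePr F n K h e V ∧
      wilsonAction4 W' = wilsonAction4 (GaugeField.gaugeAct u X) ∧
      ∀ b : PBond (F.P K) 0,
        ‖((GaugeField.gaugeAct u X b * (W b)⁻¹ : Matrix.specialUnitaryGroup (Fin 2) ℂ) : Matrix (Fin 2) (Fin 2) ℂ) - 1‖ ≤ a + c := by
  refine ⟨(gaugeAct_mem_regFibrePr_iff_of_trivial F h he hu X V).mpr hX,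
    hA.trans (T4WilsonGaugeFlatDirection.wilsonAction_gaugeAct 1 u X).symm, fun b => ?_⟩
  show ‖pertVar W (GaugeField.gaugeAct u X) b‖ ≤ a + c
  exact (norm_pertVar_gaugeAct_le W X u b).trans (add_le_add (hsup b) (hcorr b))

end T3

end Summit.QuantumFields.YangMills.Theorems.Prop7FibrePointOfPinnedRegauge

end
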